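import Summits.BirchSwinnertonDyer.BirchSwinnertonDyer.Theorems.TwoAdicConverseEisensteinCongruenceTorsionOrder
import Literature.NumberTheory.EllipticCurves.QuadraticTwistProofs
import Literature.NumberTheory.EllipticCurves.QuadraticTwistJInvariantProofs
import Literature.NumberTheory.EllipticCurves.PAdicGrossZagierConstantTermProofs
import Literature.NumberTheory.EllipticCurves.GlobalMinimalModelProofs
import Literature.NumberTheory.EllipticCurves.BSDInvariantsProofs
import Literature.NumberTheory.EllipticCurves.MazurTorsionOrderValuationProofs
import Literature.NumberTheory.EllipticCurves.ModularityVersionApProofs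
import Literature.NumberTheory.EllipticCurves.LFunctionPrimeCoeff
import Literature.NumberTheory.DiophantineGeometry.LocalReductionProofs
import Literature.AlgebraicGeometry.PlaneCurves.WeierstrassChordTangent
import Literature.NumberTheory.EllipticCurves.KrizLi2019.EisensteinHeegnerLog
import Literature.NumberTheory.EllipticCurves.MordellCurveThreeDescent
import HarnessLib

/-!
# K12r@3 — the TRACE FORM of a `j = 0` curve at the Eisenstein prime `3`:
# `a_ℓ(E) ≡ (d/ℓ)·(1 + ℓ) (mod 3)` for `E ≅ y² = x³ + d·m²`, and the `hss` binder of Kriz–Li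
# Thm. 1.20 / ROUTE U at `p = 3` DISCHARGED class-wide (cell `bsd-print-cfram`, seat p3 g1;
# PLAN v1 §2 p3, the «3-unit regime» of crux C1 `CMRamifiedThreeBSD`, stmt-BirchSwinnertonDyer-20371)

HONEST FRAMING (cell `bsd-print-cfram`, run/shared/lean/pub/bsd-print-cfram/, D-0131 (2) print
tier; verbatim in every file of the cell): the cell works the partition leaf
`CornerF ∧ p ramified in the CM field K` (LADDER-BSD row K7r = B13; W-ALL row 12r) in PARTITION
currency — a leaf or a cell counts only when its theorem is in the kernel BY NAME. Nothing here is a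
Literature statement, no named fact is introduced, nothing is asserted about BSD; beyond-print: NO
(an elementary congruence; the mechanism is Kriz–Li 2019 §7.1 / §10.1).

Seat p4's `JZeroThree.bsdp_three_of_thm120_unitRegime` (`X12/JZeroThreeUnitRegime.lean`, p538400)
is ROUTE U (`RouteU.bsdp_of_thm120_of_rem310`: Kriz–Li Thm. 1.20 ∧ Rem. 3.10 + Gross–Zagier +
Kolyvagin + GZK + the twin's `3`-part + descent inputs ⟹ `BSD(W, 3)`) at `p = 3` on the `j = 0`
leaf. Among the binders it leaves DISPLAYED exactly one is NOT a finite certificate: the trace form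
`hss` of "`E[3]^{ss} ≅ 𝔽₃(ψ) ⊕ 𝔽₃(ψ⁻¹ω)`", i.e. `‖a_ℓ(W) − (ψ(ℓ) + ψ⁻¹(ℓ)ω(ℓ))‖₃ < 1` for EVERY
prime `ℓ ∤ 3N`. This file proves it for every `j = 0` curve, `ψ` = the quadratic character of the
square class of the Mordell coefficient (the companion file `PrintCFramJZeroThreeUnitRegimeTraceForm`
plugs it into p4's theorem):

* §1 `three_dvd_torsionOrder_mordell_sq` — `y² = x³ + c²` (`c ≠ 0`) has the rational point `(0, c)`
  of order `3` (`Ψ₃(0) = b₈ = 0`, Silverman–Tate Thm. 2.1 (c)), so `3 ∣ #E(ℚ)_tors`.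
* §2 **`lFunction_modEq_three_of_sq_twist`** — for a globally minimal `W ≅ y² = x³ + d·m²` (`d ∈ ℤ`
  squarefree, `m ∈ ℚˣ`; every `j = 0` curve over `ℚ` has such a model) and every prime `ℓ ∤ 2d` of
  good reduction: **`a_ℓ(W) ≡ (d/ℓ)·(ℓ + 1) (mod 3)`**. PROOF (no CM theory): `y² = x³ + d m²` IS the
  twist by `d` of `V : y² = x³ + (m/d)²` (`quadraticTwist` on the nose); `V` has the rational
  `3`-torsion point `(0, m/d)`, so `3 ∣ #V(ℚ)_tors ∣ ℓ + 1 − a_ℓ(V)` at every good `ℓ ≥ 3` (torsion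
  injects into `Ṽ(𝔽_ℓ)`, *AEC* VII.3.1; tree `TwoAdicTwistConverse.torsionOrder_dvd_succ_sub_lFunction`);
  `a_ℓ(W) = (d/ℓ)·a_ℓ(V)` (Knapp Prop. 12.10, tree `frobeniusTrace_quadraticTwist_holds`), `V` being
  good at `ℓ` because `W^{(d)} ≅ V` and `ℓ ∤ 2d·Δ_min(W)` (tree `hasGoodReductionAt_quadraticTwist`).
  At `ℓ ≡ 2 (3)` this reads `a_ℓ ≡ 0`, at `ℓ ≡ 1 (3)` `a_ℓ ≡ −(d/ℓ)`: the trace of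
  `𝔽₃(χ_d) ⊕ 𝔽₃(χ_d ω)` at `Frob_ℓ` (Kriz–Li §10.1, `E_d[3]^{ss} = 𝔽₃(ψ_d) ⊕ 𝔽₃(ψ_d ω)`).
* §3 `teichmuller_three_apply_of_emod_eq_one / _eq_two` (`ω(ℓ) = ±1` by `ℓ mod 3`) and
  `hss_three_of_traceForm` — the `p = 3` twin of Route U's `RouteU.hss_of_traceForm` (`p = 7`).
* §4 **`hss_three_of_sq_twist`** — ASSEMBLED in the exact shape of the `hss` binder of
  `bsdp_three_of_thm120_unitRegime` / `KrizLi2019.thm120_padicLogHeegner_unit_of_bernoulli` at `3`: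
  for ANY `ℚ₃`-valued Dirichlet character `ψ` with `ψ² = 1` and `ψ(ℓ) = (d/ℓ)` at the primes
  `ℓ ≡ 1 (mod 3)`, `ℓ ∤ 3N` (nothing is asked at `ℓ ≡ 2 (mod 3)`, where `1 + ω(ℓ) = 0`), GIVEN the
  two residual per-curve facts `h2` («`a₂(W) = 0` if `W` is good at `2`» — Deuring at the inert `2`;
  vacuous when `2 ∣ N`) and `hbad` («`W` is bad at every odd prime of `d`» — Tate's algorithm for
  `y² = x³ + k` with `ord_ℓ k` odd; a discriminant check per class). Which of `χ_d`, `χ_{−3d}` is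
  called `ψ` is immaterial (Kriz–Li §7.1): a consumer may take the one UNRAMIFIED at `3`
  (`d ↦ −d/3` when `3 ∣ d`), for which (1) of Thm. 1.20 reads `ψ(3) = −1` — Thm. 1.23 (2) on `E_d`.

Not done here: the construction of `ψ` as a primitive `DirichletCharacter ℚ_[3] f` per square class
(Route U's `RouteUJacobiPsi` pattern), the decidable (1)/(3)/Bernoulli discharges, `h2`/`hbad`.
References: [KrizLi2019] Thm. 1.20, §7.1, §10.1; [SilvermanAEC2009] VII.3.1, VII.5.1, X.5.4,
Ex. 8.19; [SilvermanTate2015] Thm. 2.1 (c); [Knapp1993] Prop. 12.10; `X12/O11/RouteUTraceForm.lean`.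
-/

set_option linter.dupNamespace false
set_option autoImplicit false

noncomputable section

open scoped Classical
open NumberField IsDedekindDomain IsDedekindDomain.HeightOneSpectrum Field WeierstrassCurve
open Literature.NumberTheory.EllipticCurves Literature.NumberTheory.EllipticCurves.KrizLi2019
  Literature.NumberTheory.EllipticCurves.ModularForms Rat.HeightOneSpectrum

namespace Summit.BirchSwinnertonDyer.BirchSwinnertonDyer.Theorems.PrintCFram

/-! ## §1 The `3`-torsion point of the Mordell curve `y² = x³ + c²` (tree `mordellCurve`) -/

/-- **`3 ∣ #E(ℚ)_tors` for `E : y² = x³ + c²`, `c ≠ 0`**: `T = (0, c)` is a rational point with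
`Ψ₃(0) = b₈ = 0`, so `T` has order `3` (Silverman–Tate Thm. 2.1 (c); tree
`addOrderOf_eq_three_iff_Ψ₃_eval_eq_zero`), and Lagrange in `E(ℚ)_tors`.
[cite: SilvermanTate2015, §2.1 Thm. 2.1 (c), p. 39] [cite: SilvermanAEC2009, VIII.7 (the torsion subgroup)] -/
theorem three_dvd_torsionOrder_mordell_sq {c : ℚ} (hc : c ≠ 0) :
    3 ∣ (mordellCurve (c ^ 2)).torsionOrder := by
  set E : WeierstrassCurve ℚ := mordellCurve (c ^ 2) with hE
  have hns : E.toAffine.Nonsingular 0 c := by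
    rw [WeierstrassCurve.Affine.nonsingular_iff']
    refine ⟨?_, Or.inr ?_⟩
    · rw [WeierstrassCurve.Affine.equation_iff']
      simp [hE, mordellCurve]
    · simp [hE, mordellCurve, hc]
  set T : E.toAffine.Point := WeierstrassCurve.Affine.Point.some 0 c hns with hT
  have h3 : addOrderOf T = 3 := by
    rw [hT, Literature.AlgebraicGeometry.PlaneCurves.addOrderOf_eq_three_iff_Ψ₃_eval_eq_zero E hns]
    simp [WeierstrassCurve.Ψ₃, WeierstrassCurve.b₂, WeierstrassCurve.b₄, WeierstrassCurve.b₆,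
      WeierstrassCurve.b₈, hE, mordellCurve]
  have hfin : IsOfFinAddOrder T := addOrderOf_pos_iff.mp (by rw [h3]; norm_num)
  exact h3 ▸ addOrderOf_dvd_torsionOrder E hfin

/-! ## §2 The trace form `a_ℓ(W) ≡ (d/ℓ)(ℓ + 1) (mod 3)` -/

/-- **THE TRACE FORM OF A `j = 0` CURVE AT `3`.** Let `W/ℚ` be globally minimal and
`ℚ`-isomorphic to `y² = x³ + d·m²` with `d ∈ ℤ` squarefree and `m ∈ ℚˣ`, and let `ℓ ∤ 2d` be a prime
of good reduction. Then **`a_ℓ(W) ≡ (d/ℓ)·(ℓ + 1) (mod 3)`** (`a_ℓ = W.LFunction ℓ`). Proof: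
`y² = x³ + d m² = V^{(d)}` for `V : y² = x³ + (m/d)²` (the tree's `quadraticTwist`, on the nose), `V` carries the
rational `3`-torsion point `(0, m/d)` so `3 ∣ #V(ℚ)_tors ∣ ℓ + 1 − a_ℓ(V)`
(`torsionOrder_dvd_succ_sub_lFunction`, torsion injects modulo a good `ℓ ≥ 3`), `V` is good at `ℓ`
because `W^{(d)} ≅ V` and `ℓ ∤ 2d·Δ_min(W)` (`hasGoodReductionAt_quadraticTwist`), and
`a_ℓ(W) = (d/ℓ)·a_ℓ(V)` (`frobeniusTrace_quadraticTwist_holds`). This is the congruence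
`a_ℓ ≡ ψ(ℓ) + ψ⁻¹(ℓ)ω(ℓ)` for `ψ = χ_d`, `ω` the mod-`3` cyclotomic character (Kriz–Li 2019 §10:
`E_d[3]^{ss} ≅ 𝔽₃(ψ_d) ⊕ 𝔽₃(ψ_d ω)`). [cite: KrizLi2019, §10.1 and Thm. 1.20 (pp. 7–8) (the reducible E[3] of a sextic twist)]
[cite: SilvermanAEC2009, VII.3 Prop. 3.1(b) and Exercise 8.19] [cite: Knapp1993, Prop. 12.10 (PDF pp. 302–303)] -/
theorem lFunction_modEq_three_of_sq_twist (W : WeierstrassCurve ℚ) [W.IsElliptic] [W.IsGloballyMinimal]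
    {d : ℤ} (hd : Squarefree d) {m : ℚ} (hm : m ≠ 0)
    (hW : ∃ C : VariableChange ℚ, C • W = mordellCurve ((d : ℚ) * m ^ 2))
    (ℓ : ℕ) [hℓ : Fact ℓ.Prime] (hℓd : ¬ (ℓ : ℤ) ∣ 2 * d) (hgood : W.HasGoodReductionAtPrime ℓ) :
    (W.LFunction ℓ : ℤ) ≡ legendreSym ℓ d * ((ℓ : ℤ) + 1) [ZMOD 3] := by
  have hd0 : d ≠ 0 := hd.ne_zero
  have hdQ : (d : ℚ) ≠ 0 := by exact_mod_cast hd0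
  have hℓ2 : ℓ ≠ 2 := by
    rintro rfl
    exact hℓd (dvd_mul_right 2 d)
  have hℓ3 : 3 ≤ ℓ := by
    have h2 := hℓ.out.two_le
    omega
  -- the auxiliary curve `V₀ : y² = x³ + (m/d)²` with its rational `3`-torsion point, and `y² = x³ + d m² = V₀^{(d)}`
  set V₀ : WeierstrassCurve ℚ := mordellCurve ((m / d) ^ 2) with hV₀
  have hmd : m / d ≠ 0 := div_ne_zero hm hdQ
  haveI hV₀ell : V₀.IsElliptic := isElliptic_mordellCurve (pow_ne_zero 2 hmd)
  -- `(y² = x³ + B)^{(e)} = (y² = x³ + e³B)` on the nose (`b₂ = b₄ = 0`, `b₆ = 4B`)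
  have hqt : ∀ B e : ℚ, (mordellCurve B).quadraticTwist e = mordellCurve (e ^ 3 * B) := by
    intro B e
    ext
    · rfl
    · simp [WeierstrassCurve.quadraticTwist, mordellCurve, WeierstrassCurve.b₂]
    · rfl
    · simp [WeierstrassCurve.quadraticTwist, mordellCurve, WeierstrassCurve.b₄]
    · simp only [WeierstrassCurve.quadraticTwist, mordellCurve, WeierstrassCurve.b₆]
      ring
  have htw : V₀.quadraticTwist (d : ℚ) = mordellCurve ((d : ℚ) * m ^ 2) := by
    rw [hV₀, hqt]
    congr 1
    field_simp
  have htw1 : V₀.quadraticTwist 1 = V₀ := by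
    rw [hV₀, hqt]
    congr 1
    ring
  -- a globally minimal model `V = C₁ • V₀`
  obtain ⟨C₁, hC₁⟩ := hasGlobalMinimalModel_rat_holds V₀
  haveI := hC₁
  set V : WeierstrassCurve ℚ := C₁ • V₀ with hV
  have h3V : 3 ∣ V.torsionOrder := by
    have ht : (C₁ • V₀).torsionOrder = V₀.torsionOrder := torsionOrder_variableChange_holds V₀ C₁
    rw [hV, ht, hV₀]
    exact three_dvd_torsionOrder_mordell_sq hmd
  -- `W` is a model of `V^{(d)}`
  obtain ⟨C, hC⟩ := hW
  have hWV : ∃ C' : VariableChange ℚ, C' • W = V.quadraticTwist (d : ℚ) :=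
    ⟨⟨C₁.u, (d : ℚ) * C₁.r, 0, 0⟩ * C, by rw [mul_smul, hC, ← htw, hV, quadraticTwist_smul]⟩
  -- `W^{(d)} ≅ V`
  obtain ⟨C₂, hC₂⟩ := V₀.exists_variableChange_quadraticTwist_mul_sq 1 (d : ℚ) hdQ
  have hC₂' : C₂ • V₀ = V₀.quadraticTwist ((d : ℚ) * d) := by
    conv_lhs => rw [← htw1]
    rw [hC₂]
    congr 1
    ring
  have hWd : W.quadraticTwist (d : ℚ) =
      ((⟨C⁻¹.u, (d : ℚ) * C⁻¹.r, 0, 0⟩ : VariableChange ℚ) * C₂ * C₁⁻¹) • V := by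
    have hW' : W = C⁻¹ • V₀.quadraticTwist (d : ℚ) := by rw [htw, ← hC, inv_smul_smul]
    rw [hW', quadraticTwist_smul, quadraticTwist_quadraticTwist, mul_smul, mul_smul, hV, inv_smul_smul,
      hC₂']
  -- good reduction of `V` at `ℓ`, from that of `W` (`ℓ ∤ 2d`)
  obtain ⟨v, hv⟩ : ∃ v : HeightOneSpectrum (𝓞 ℚ), (primesEquiv v : ℕ) = ℓ :=
    ⟨primesEquiv.symm ⟨ℓ, hℓ.out⟩, by rw [Equiv.apply_symm_apply]⟩
  have hΔW : ¬ (ℓ : ℤ) ∣ minimalDiscriminantInt W :=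
    W.not_dvd_minimalDiscriminantInt_of_hasGoodReductionAtPrime ℓ hgood
  have hgoodWd : (W.quadraticTwist (d : ℚ)).HasGoodReductionAt v :=
    W.hasGoodReductionAt_quadraticTwist v (by rw [hv]; exact hℓd) (by rw [hv]; exact hΔW)
  have hgoodV : V.HasGoodReductionAt v := by
    rw [hWd] at hgoodWd
    exact (WeierstrassCurve.hasGoodReductionAt_smul_iff_holds v V _).mp hgoodWd
  have hgoodV' : V.HasGoodReductionAtPrime ℓ :=
    (hasGoodReductionAtPrime_primesEquiv_iff_holds V v ℓ hv).mpr hgoodV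
  have hΔV : ¬ (ℓ : ℤ) ∣ minimalDiscriminantInt V :=
    V.not_dvd_minimalDiscriminantInt_of_hasGoodReductionAtPrime ℓ hgoodV'
  -- the twisting formula and the torsion congruence
  have htwist : W.frobeniusTrace ℓ = legendreSym ℓ d * V.frobeniusTrace ℓ :=
    frobeniusTrace_quadraticTwist_holds V W d hd hWV ℓ hℓd hΔV
  have htor : ((V.torsionOrder : ℕ) : ℤ) ∣ (ℓ : ℤ) + 1 - V.LFunction ℓ :=
    Summit.BirchSwinnertonDyer.BirchSwinnertonDyer.Theorems.TwoAdicTwistConverse.torsionOrder_dvd_succ_sub_lFunction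
      V ℓ hℓ3 hgoodV'
  have h3a : (3 : ℤ) ∣ (ℓ : ℤ) + 1 - V.LFunction ℓ := dvd_trans (by exact_mod_cast h3V) htor
  have hVmod : V.LFunction ℓ ≡ (ℓ : ℤ) + 1 [ZMOD 3] := Int.modEq_iff_dvd.mpr h3a
  rw [W.LFunction_apply_prime_eq_frobeniusTrace ℓ hgood, htwist,
    ← V.LFunction_apply_prime_eq_frobeniusTrace ℓ hgoodV']
  exact hVmod.mul_left _

/-- The trace form in Jacobi-symbol currency (total in `ℓ`): `a_ℓ(W) ≡ J(d | ℓ)·(ℓ + 1) (mod 3)` at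
every prime `ℓ ∤ 2d` of good reduction. [cite: KrizLi2019, §10.1 and Thm. 1.20 (pp. 7–8)] -/
theorem lFunction_modEq_three_of_sq_twist_jacobi (W : WeierstrassCurve ℚ) [W.IsElliptic]
    [W.IsGloballyMinimal] {d : ℤ} (hd : Squarefree d) {m : ℚ} (hm : m ≠ 0)
    (hW : ∃ C : VariableChange ℚ, C • W = mordellCurve ((d : ℚ) * m ^ 2))
    (ℓ : ℕ) [Fact ℓ.Prime] (hℓd : ¬ (ℓ : ℤ) ∣ 2 * d) (hgood : W.HasGoodReductionAtPrime ℓ) :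
    (W.LFunction ℓ : ℤ) ≡ jacobiSym d ℓ * ((ℓ : ℤ) + 1) [ZMOD 3] := by
  rw [← jacobiSym.legendreSym.to_jacobiSym]
  exact lFunction_modEq_three_of_sq_twist W hd hm hW ℓ hℓd hgood

/-! ## §3 The Teichmüller character mod `3`, and `hss` from a mod-`3` trace form -/

/-- In `ℚ_p`: if `‖x − a‖ < 1` for an integer `a` then `‖x‖ ≤ 1`. [folklore] -/
private theorem norm_le_one_of_norm_sub_intCast_lt_one {p : ℕ} [Fact p.Prime] {x : ℚ_[p]} {a : ℤ}
    (h : ‖x - (a : ℚ_[p])‖ < 1) : ‖x‖ ≤ 1 := by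
  have : x = (x - a) + a := by ring
  rw [this]
  exact (Padic.nonarchimedean _ _).trans (max_le h.le (Padic.norm_int_le_one a))

/-- The values of a Teichmüller character mod `3` are `±1` (`ω(a)² = 1` in the field `ℚ₃`).
[cite: Washington1997, §5.1 (the Teichmüller character `ω`)] -/
theorem teichmuller_three_sq_cases (ω : DirichletCharacter ℚ_[3] 3) (a : ℤ) (ha : ¬ ((3 : ℤ) ∣ a)) :
    ω (a : ZMod 3) = 1 ∨ ω (a : ZMod 3) = -1 := by
  haveI : Fact (Nat.Prime 3) := ⟨Nat.prime_three⟩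
  have h := apply_pow_sub_one_eq_one ω a (by exact_mod_cast ha)
  norm_num at h
  exact h

/-- **`ω(a) = 1` for `a ≡ 1 (mod 3)`** (`ω(a) ≡ a ≡ 1` and `ω(a) = ±1`; `‖−1 − a‖₃ = ‖a + 1‖₃ = 1`
rules out `−1`). [cite: Washington1997, §5.1 (the Teichmüller character `ω(a) ≡ a mod p`)] -/
theorem teichmuller_three_apply_of_emod_eq_one {ω : DirichletCharacter ℚ_[3] 3}
    (hω : IsTeichmullerCharacter ω) (a : ℤ) (ha : a % 3 = 1) : ω (a : ZMod 3) = 1 := by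
  haveI : Fact (Nat.Prime 3) := ⟨Nat.prime_three⟩
  have ha3 : ¬ ((3 : ℤ) ∣ a) := by omega
  rcases teichmuller_three_sq_cases ω a ha3 with h | h
  · exact h
  · exfalso
    have hlt := hω a (by exact_mod_cast ha3)
    rw [h, show (-1 : ℚ_[3]) - (a : ℚ_[3]) = ((-(a + 1) : ℤ) : ℚ_[3]) by push_cast; ring,
      Padic.norm_intCast_lt_one_iff] at hlt
    have h3 : (3 : ℤ) ∣ -(a + 1) := by exact_mod_cast hlt
    omega

/-- **`ω(a) = −1` for `a ≡ 2 (mod 3)`** (`ω(a) ≡ a ≡ −1`; `‖1 − a‖₃ = 1` rules out `+1`).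
[cite: Washington1997, §5.1 (the Teichmüller character `ω(a) ≡ a mod p`)] -/
theorem teichmuller_three_apply_of_emod_eq_two {ω : DirichletCharacter ℚ_[3] 3}
    (hω : IsTeichmullerCharacter ω) (a : ℤ) (ha : a % 3 = 2) : ω (a : ZMod 3) = -1 := by
  haveI : Fact (Nat.Prime 3) := ⟨Nat.prime_three⟩
  have ha3 : ¬ ((3 : ℤ) ∣ a) := by omega
  rcases teichmuller_three_sq_cases ω a ha3 with h | h
  · exfalso
    have hlt := hω a (by exact_mod_cast ha3)
    rw [h, show (1 : ℚ_[3]) - (a : ℚ_[3]) = ((-(a - 1) : ℤ) : ℚ_[3]) by push_cast; ring,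
      Padic.norm_intCast_lt_one_iff] at hlt
    have h3 : (3 : ℤ) ∣ -(a - 1) := by exact_mod_cast hlt
    omega
  · exact h

/-- **`hss` from a mod-`3` trace form** (the `p = 3` twin of Route U's `RouteU.hss_of_traceForm`).
Let `W/ℚ`, `ω` a Teichmüller character mod `3`, `ψ` any Dirichlet character with values in `ℚ₃`.
If for every prime `ℓ ∤ 3N` there is an integer `ε_ℓ` with (a) `a_ℓ(W) ≡ ε_ℓ(ℓ + 1) (mod 3)` and
(b) `ψ(ℓ) + ψ⁻¹(ℓ)ω(ℓ) = ε_ℓ·(1 + ω(ℓ))`, then the trace-form hypothesis of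
`KrizLi2019.thm120_padicLogHeegner_unit_of_bernoulli` at `p = 3` holds:
`‖a_ℓ − (ψ(ℓ) + ψ⁻¹(ℓ)ω(ℓ))‖₃ < 1` for all primes `ℓ ∤ 3N`. [cite: KrizLi2019, Thm. 1.20 and §2 (trace form of E[p]^{ss})] -/
theorem hss_three_of_traceForm (W : WeierstrassCurve ℚ) {f : ℕ} (ψ : DirichletCharacter ℚ_[3] f)
    (ω : DirichletCharacter ℚ_[3] 3) (hω : IsTeichmullerCharacter ω) (ε : ℕ → ℤ)
    (ha : ∀ ℓ : ℕ, ℓ.Prime → ¬ (ℓ ∣ 3 * W.conductorNorm ℤ) →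
      (W.LFunction ℓ : ℤ) ≡ ε ℓ * ((ℓ : ℤ) + 1) [ZMOD 3])
    (hψ : ∀ ℓ : ℕ, ℓ.Prime → ¬ (ℓ ∣ 3 * W.conductorNorm ℤ) →
      ψ (ℓ : ZMod f) + ψ⁻¹ (ℓ : ZMod f) * ω (ℓ : ZMod 3) =
        (ε ℓ : ℚ_[3]) * (1 + ω (ℓ : ZMod 3))) :
    ∀ ℓ : ℕ, ℓ.Prime → ¬ (ℓ ∣ 3 * W.conductorNorm ℤ) →
      ‖((W.LFunction ℓ : ℤ) : ℚ_[3]) -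
        (ψ (ℓ : ZMod f) + ψ⁻¹ (ℓ : ZMod f) * ω (ℓ : ZMod 3))‖ < 1 := by
  haveI : Fact (Nat.Prime 3) := ⟨Nat.prime_three⟩
  intro ℓ hℓ hℓN
  have hℓ3 : ¬ ((3 : ℤ) ∣ (ℓ : ℤ)) := by
    intro h
    have h' : 3 ∣ ℓ := by exact_mod_cast h
    have h33 : ℓ = 3 := ((Nat.prime_dvd_prime_iff_eq (by norm_num) hℓ).mp h').symm
    rw [h33] at hℓN
    exact hℓN (dvd_mul_right 3 _)
  rw [hψ ℓ hℓ hℓN]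
  -- `ω(ℓ) ≡ ℓ`, hence `1 + ω(ℓ) ≡ 1 + ℓ (mod 3ℤ₃)`
  have hωℓ : ‖ω (ℓ : ZMod 3) - (ℓ : ℚ_[3])‖ < 1 := by
    have := hω (ℓ : ℤ) hℓ3
    push_cast at this
    exact this
  have hS : ‖(1 + ω (ℓ : ZMod 3)) - (1 + (ℓ : ℚ_[3]))‖ < 1 := by
    have e : (1 + ω (ℓ : ZMod 3)) - (1 + (ℓ : ℚ_[3])) = ω (ℓ : ZMod 3) - (ℓ : ℚ_[3]) := by ring
    rw [e]; exact hωℓ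
  -- `a_ℓ ≡ ε_ℓ(ℓ + 1) (mod 3)` as an integer congruence
  have hA : ‖((W.LFunction ℓ : ℤ) : ℚ_[3]) - (ε ℓ : ℚ_[3]) * (1 + (ℓ : ℚ_[3]))‖ < 1 := by
    have hdvd : ((3 : ℕ) : ℤ) ∣ W.LFunction ℓ - ε ℓ * ((ℓ : ℤ) + 1) := by
      exact_mod_cast (ha ℓ hℓ hℓN).symm.dvd
    have := (Padic.norm_intCast_lt_one_iff (p := 3)).mpr hdvd
    push_cast at this
    rw [show (ε ℓ : ℚ_[3]) * (1 + (ℓ : ℚ_[3])) = (ε ℓ : ℚ_[3]) * ((ℓ : ℚ_[3]) + 1) by ring]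
    exact this
  -- `ε_ℓ·(1 + ω(ℓ)) ≡ ε_ℓ·(1 + ℓ)`
  have hB : ‖(ε ℓ : ℚ_[3]) * (1 + (ℓ : ℚ_[3])) - (ε ℓ : ℚ_[3]) * (1 + ω (ℓ : ZMod 3))‖ < 1 := by
    rw [← mul_sub, norm_mul, norm_sub_rev]
    calc ‖(ε ℓ : ℚ_[3])‖ * ‖(1 + ω (ℓ : ZMod 3)) - (1 + (ℓ : ℚ_[3]))‖
        ≤ 1 * ‖(1 + ω (ℓ : ZMod 3)) - (1 + (ℓ : ℚ_[3]))‖ :=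
          mul_le_mul_of_nonneg_right (Padic.norm_int_le_one _) (norm_nonneg _)
      _ < 1 := by rw [one_mul]; exact hS
  have e : ((W.LFunction ℓ : ℤ) : ℚ_[3]) - (ε ℓ : ℚ_[3]) * (1 + ω (ℓ : ZMod 3)) =
      (((W.LFunction ℓ : ℤ) : ℚ_[3]) - (ε ℓ : ℚ_[3]) * (1 + (ℓ : ℚ_[3]))) +
      ((ε ℓ : ℚ_[3]) * (1 + (ℓ : ℚ_[3])) - (ε ℓ : ℚ_[3]) * (1 + ω (ℓ : ZMod 3))) := by ring
  rw [e]
  exact (Padic.nonarchimedean _ _).trans_lt (max_lt hA hB)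

/-! ## §4 The `hss` binder of `bsdp_three_of_thm120_unitRegime` for `W ≅ y² = x³ + d·m²` -/

/-- **The `hss` binder of Kriz–Li Thm. 1.20 / ROUTE U at `p = 3`, DISCHARGED for every model of
`y² = x³ + d·m²`.** Let `W/ℚ` be globally minimal with `C • W = y² = x³ + d·m²` (`d` squarefree,
`m ≠ 0`), `ω` a Teichmüller character mod `3`, and `ψ` a `ℚ₃`-valued Dirichlet character of any
level `f` with `ψ² = 1` whose values at the primes `ℓ ≡ 1 (mod 3)`, `ℓ ∤ 3N`, are the Kronecker
symbols: `ψ(ℓ) = (d/ℓ)` (e.g. `ψ = χ_d` or `χ_{−3d}`; nothing is asked at `ℓ ≡ 2 (mod 3)`). Assume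
the two residual per-curve facts `h2` (at a GOOD prime `2`, `a₂(W) = 0` — Deuring, `2` is inert in
`ℚ(√−3)`; vacuous when `2 ∣ N`) and `hbad` (`W` is bad at every odd prime dividing `d` — Tate's
algorithm for `y² = x³ + k`, `ord_ℓ k` odd). Then for every prime `ℓ ∤ 3N`:
`‖a_ℓ(W) − (ψ(ℓ) + ψ⁻¹(ℓ)ω(ℓ))‖₃ < 1` — literally the `hss` binder of
`JZeroThree.bsdp_three_of_thm120_unitRegime`. Proof: §2 at `ℓ ∤ 2d` (`a_ℓ ≡ (d/ℓ)(ℓ+1)`), `h2`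
at `ℓ = 2` (`1 + ω(2) = 0`), `hbad` excludes `ℓ ∣ d`; then §3 with `ε_ℓ = J(d | ℓ)`, using
`ω(ℓ) = ±1` according to `ℓ mod 3`. [cite: KrizLi2019, Thm. 1.20 (pp. 7–8), §7.1 (p. 42, «we may assume ψ ≠ ω»), §10.1]
[cite: SilvermanAEC2009, VII.3 Prop. 3.1(b), X.5 Prop. 5.4] -/
theorem hss_three_of_sq_twist (W : WeierstrassCurve ℚ) [W.IsElliptic] [W.IsGloballyMinimal]
    {d : ℤ} (hd : Squarefree d) {m : ℚ} (hm : m ≠ 0)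
    (hW : ∃ C : VariableChange ℚ, C • W = mordellCurve ((d : ℚ) * m ^ 2))
    (h2 : (haveI : Fact (Nat.Prime 2) := ⟨Nat.prime_two⟩; W.HasGoodReductionAtPrime 2) →
      W.LFunction 2 = 0)
    (hbad : ∀ ℓ : ℕ, (hℓ : ℓ.Prime) → (ℓ : ℤ) ∣ d → ℓ ≠ 2 →
      ¬ (haveI := Fact.mk hℓ; W.HasGoodReductionAtPrime ℓ))
    {f : ℕ} (ψ : DirichletCharacter ℚ_[3] f) (ω : DirichletCharacter ℚ_[3] 3)
    (hω : IsTeichmullerCharacter ω) (hψ2 : ψ * ψ = 1)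
    (hψ : ∀ ℓ : ℕ, ℓ.Prime → ¬ (ℓ ∣ 3 * W.conductorNorm ℤ) → ℓ % 3 = 1 →
      ψ (ℓ : ZMod f) = ((jacobiSym d ℓ : ℤ) : ℚ_[3])) :
    ∀ ℓ : ℕ, ℓ.Prime → ¬ (ℓ ∣ 3 * W.conductorNorm ℤ) →
      ‖((W.LFunction ℓ : ℤ) : ℚ_[3]) -
        (ψ (ℓ : ZMod f) + ψ⁻¹ (ℓ : ZMod f) * ω (ℓ : ZMod 3))‖ < 1 := by
  haveI : Fact (Nat.Prime 3) := ⟨Nat.prime_three⟩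
  have hψinv : ψ⁻¹ = ψ := inv_eq_of_mul_eq_one_right hψ2
  -- good reduction at every prime `ℓ ∤ 3N`
  have hgood : ∀ ℓ : ℕ, (hℓ : ℓ.Prime) → ¬ (ℓ ∣ 3 * W.conductorNorm ℤ) →
      (haveI := Fact.mk hℓ; W.HasGoodReductionAtPrime ℓ) := by
    intro ℓ hℓ hℓN
    haveI := Fact.mk hℓ
    by_contra hng
    exact hℓN (dvd_mul_of_dvd_right ((W.dvd_conductorNorm_iff_not_hasGoodReductionAtPrime ℓ).mpr hng) 3)
  -- `ℓ mod 3 ∈ {1, 2}` for a prime `ℓ ∤ 3N`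
  have hmod : ∀ ℓ : ℕ, ℓ.Prime → ¬ (ℓ ∣ 3 * W.conductorNorm ℤ) → ℓ % 3 = 1 ∨ ℓ % 3 = 2 := by
    intro ℓ hℓ hℓN
    have h3 : ℓ ≠ 3 := by rintro rfl; exact hℓN (dvd_mul_right 3 _)
    have h0 : ℓ % 3 ≠ 0 := by
      intro h0
      have h3ℓ : 3 ∣ ℓ := Nat.dvd_of_mod_eq_zero h0
      exact h3 ((Nat.prime_dvd_prime_iff_eq Nat.prime_three hℓ).mp h3ℓ).symm
    omega
  refine hss_three_of_traceForm W ψ ω hω (fun ℓ ↦ jacobiSym d ℓ) ?_ ?_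
  · -- (a) the integer congruence `a_ℓ ≡ J(d|ℓ)(ℓ + 1) (mod 3)`
    intro ℓ hℓ hℓN
    haveI := Fact.mk hℓ
    have hg := hgood ℓ hℓ hℓN
    by_cases hℓd : (ℓ : ℤ) ∣ 2 * d
    · -- `ℓ = 2` (then `a₂ = 0` and `3 ∣ 2 + 1`) — the case `ℓ ∣ d`, `ℓ` odd is excluded by `hbad`
      have hℓ2 : ℓ = 2 := by
        by_contra hne
        have hℓZ : Prime (ℓ : ℤ) := Nat.prime_iff_prime_int.mp hℓ
        rcases hℓZ.dvd_or_dvd hℓd with h | h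
        · have : ℓ ∣ 2 := by exact_mod_cast h
          exact hne ((Nat.prime_dvd_prime_iff_eq hℓ Nat.prime_two).mp this)
        · exact hbad ℓ hℓ h hne hg
      subst hℓ2
      rw [h2 hg]
      exact Int.modEq_iff_dvd.mpr ⟨jacobiSym d 2, by push_cast; ring⟩
    · exact lFunction_modEq_three_of_sq_twist_jacobi W hd hm hW ℓ hℓd hg
  · -- (b) the character identity `ψ(ℓ) + ψ⁻¹(ℓ)ω(ℓ) = J(d|ℓ)(1 + ω(ℓ))`
    intro ℓ hℓ hℓN
    rw [hψinv]
    rcases hmod ℓ hℓ hℓN with h1 | h2'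
    · have hω1 : ω (ℓ : ZMod 3) = 1 :=
        by exact_mod_cast teichmuller_three_apply_of_emod_eq_one hω (ℓ : ℤ) (by exact_mod_cast h1)
      rw [hω1, hψ ℓ hℓ hℓN h1]
      ring
    · have hω2 : ω (ℓ : ZMod 3) = -1 :=
        by exact_mod_cast teichmuller_three_apply_of_emod_eq_two hω (ℓ : ℤ) (by exact_mod_cast h2')
      rw [hω2]
      ring

end Summit.BirchSwinnertonDyer.BirchSwinnertonDyer.Theorems.PrintCFram

end
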